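import Literature.MathematicalPhysics.QuantumLattice.LiebWuChemicalPotentialEnergy
import Literature.MathematicalPhysics.QuantumLattice.LiebWuEnergyAtFillingBracket
import HarnessLib

/-!
# Lieb–Wu 2003, §7 / §7.1, eq. (mmu): `μ₋(U) = 2 - 4∫₀^∞ J₁(ω)/(ω[1 + exp(ωU/2)]) dω` is the left
# derivative of the energy density with respect to the density at half filling

E. H. Lieb, F. Y. Wu, Physica A 321 (2003) 1, §7 (arXiv:cond-mat/0207529 pp. 15–16):

> In the thermodynamic limit … `E(N) = N_a e(N/N_a)` … It is contained in (energy1) when `N/N_a ≤ 1`. …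
> `μ₊ =` right derivative and `μ₋ =` left derivative are well defined. … We calculate `μ₋` in two ways,
> and arrive at the same conclusion `μ₋(U) = 2 - 4∫₀^∞ J₁(ω)/(ω[1 + exp(ωU/2)]) dω`.   (mmu)
> The first way is to calculate `μ₋` from the integral equations by doing perturbation theory at the
> half-filling point … Our goal is to calculate `δE` … and `δN` …; `μ₋` is the quotient of the two
> numbers. … By dividing (finaldeltae) by (en) we obtain (mmu).

In the tree, the energy (energy1) = PRL eq. (17) as a function of the density `n = N/N_a ∈ (0, 1]` is
`liebWuEnergyAtFilling U n = liebWuEnergyAtCutoff U (liebWuCutoffAtFilling U n)` (`LiebWuEnergyAtFilling`;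
the cutoff at density `n` is unique, `LiebWuFillingMonotone`), and `μ₋ = liebWuMuMinus U` (PRL eq. (22)).
This file performs the division of (finaldeltae) (`LiebWuChemicalPotentialEnergy`:
`e(Q) - e(π) = (Q - π)(2/π - 2ρ₀(0)) μ₋ + O((π - Q)²)`) by (en) (`LiebWuChemicalPotentialFilling`:
`N/N_a(Q) - 1 = (Q - π)(2/π - 2ρ₀(0)) + O((π - Q)²)`, with `2/π - 2ρ₀(0) > 0`):

* `hasDerivWithinAt_liebWuEnergyAtFilling_one`: for `U > 0`,
  `HasDerivWithinAt (liebWuEnergyAtFilling U) (liebWuMuMinus U) (Iic 1) 1` — **`μ₋` of (mmu) is the left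
  derivative of `n ↦ e(n)` at `n = 1`.**

No named facts; all statements proved.

## References

* E. H. Lieb, F. Y. Wu, Physica A 321 (2003) 1–27 = arXiv:cond-mat/0207529, §7, eq. (mmu); §7.1,
  eqs. (en), (finaldeltae) [LiebWuPhysicaA2003].
* E. H. Lieb, F. Y. Wu, Phys. Rev. Lett. 20 (1968) 1445, eqs. (17), (22) [LiebWuPRL1968].
-/

noncomputable section

open MeasureTheory Set Real Filter
open Literature.Analysis.SpecialFunctions Literature.Analysis.FunctionSpaces
open scoped Topology

namespace Literature.MathematicalPhysics.QuantumLattice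

variable {U : ℝ}

/-- **Lieb–Wu 2003, eq. (mmu): `μ₋ = 2 - 4∫₀^∞ J₁(ω)/(ω(1 + e^{ωU/2})) dω` is the left derivative at half
filling (`N/N_a = 1`) of the Bethe-ansatz energy density as a function of the density** — "by dividing
(finaldeltae) by (en) we obtain (mmu)". [cite: LiebWuPhysicaA2003, §7, eq. (mmu); §7.1] -/
theorem hasDerivWithinAt_liebWuEnergyAtFilling_one (hU : 0 < U) :
    HasDerivWithinAt (liebWuEnergyAtFilling U) (liebWuMuMinus U) (Iic 1) 1 := by
  have hπ := Real.pi_pos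
  obtain ⟨Ce, hCe⟩ := abs_liebWuEnergyAtCutoff_sub_linear_le hU
  obtain ⟨Cf, hCf⟩ := abs_liebWuFillingAtCutoff_sub_linear_le hU
  have hsq : (π - (π - 1)) ^ 2 = 1 := by ring
  have hCe0 : 0 ≤ Ce := by
    have h1 := hCe (π - 1) ⟨le_rfl, by linarith⟩
    rw [hsq, mul_one] at h1
    exact (abs_nonneg _).trans h1
  have hCf0 : 0 ≤ Cf := by
    have h1 := hCf (π - 1) ⟨le_rfl, by linarith⟩
    rw [hsq, mul_one] at h1
    exact (abs_nonneg _).trans h1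
  set d : ℝ := 2 / π - 2 * liebWuRho0 U 0 with hd
  have hd0 : 0 < d := deriv_liebWuFillingAtCutoff_pi_pos hU
  set μ : ℝ := liebWuMuMinus U with hμ
  set K : ℝ := Ce + Cf * |μ| with hK
  have hK0 : 0 ≤ K := by positivity
  -- the cutoff at density `n` tends to `π` as `n → 1⁻`
  have hIoc : Ioc (0 : ℝ) 1 ∈ 𝓝[Iic 1] (1 : ℝ) := Ioc_mem_nhdsLE zero_lt_one
  have hcont : ContinuousWithinAt (liebWuCutoffAtFilling U) (Iic 1) 1 :=
    (continuousOn_liebWuCutoffAtFilling hU 1 ⟨zero_lt_one, le_rfl⟩).mono_of_mem_nhdsWithin hIoc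
  have hQ1 : liebWuCutoffAtFilling U 1 = π := liebWuCutoffAtFilling_one hU
  have hE1 : liebWuEnergyAtFilling U 1 = liebWuEnergyAtCutoff U π := by
    rw [liebWuEnergyAtFilling_one hU, liebWuEnergyAtCutoff_pi hU]
  rw [hasDerivWithinAt_iff_isLittleO, Asymptotics.isLittleO_iff]
  intro ε hε
  -- the size of the left neighbourhood of `π` on which the two expansions are used
  set η : ℝ := min 1 (min (d / (2 * (Cf + 1))) (ε * d / (2 * (K + 1)))) with hη
  have hη0 : 0 < η := lt_min one_pos (lt_min (by positivity) (by positivity))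
  have hη1 : η ≤ 1 := min_le_left _ _
  have hη2 : η ≤ d / (2 * (Cf + 1)) := (min_le_right _ _).trans (min_le_left _ _)
  have hη3 : η ≤ ε * d / (2 * (K + 1)) := (min_le_right _ _).trans (min_le_right _ _)
  have hev : ∀ᶠ n in 𝓝[Iic 1] (1 : ℝ), π - η < liebWuCutoffAtFilling U n := by
    have h := hcont.tendsto
    rw [hQ1] at h
    exact h.eventually (lt_mem_nhds (by linarith))
  filter_upwards [hIoc, hev] with n hn hQn
  have hQπ : liebWuCutoffAtFilling U n ≤ π := (liebWuCutoffAtFilling_spec hU hn).1.2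
  have hfQ : liebWuFillingAtCutoff U (liebWuCutoffAtFilling U n) = n := (liebWuCutoffAtFilling_spec hU hn).2
  have hEn : liebWuEnergyAtFilling U n = liebWuEnergyAtCutoff U (liebWuCutoffAtFilling U n) := rfl
  set Q : ℝ := liebWuCutoffAtFilling U n with hQdef
  have hx0 : 0 ≤ π - Q := by linarith
  have hxη : π - Q < η := by linarith
  have hQI : Q ∈ Icc (π - 1) π := ⟨by linarith, hQπ⟩
  have hre : |liebWuEnergyAtCutoff U Q - liebWuEnergyAtCutoff U π - (Q - π) * (d * μ)| ≤ Ce * (π - Q) ^ 2 :=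
    hCe Q hQI
  have hrf : |liebWuFillingAtCutoff U Q - 1 - (Q - π) * d| ≤ Cf * (π - Q) ^ 2 := hCf Q hQI
  -- `δE - μ₋ δN = (δE - (Q - π) d μ₋) - (δN - (Q - π) d) μ₋`
  have hid : liebWuEnergyAtFilling U n - liebWuEnergyAtFilling U 1 - (n - 1) * μ =
      (liebWuEnergyAtCutoff U Q - liebWuEnergyAtCutoff U π - (Q - π) * (d * μ)) -
        (liebWuFillingAtCutoff U Q - 1 - (Q - π) * d) * μ := by
    rw [hfQ, hE1, hEn]; ring
  rw [smul_eq_mul, hid, Real.norm_eq_abs, Real.norm_eq_abs]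
  -- `|δN| ≥ d (π - Q) / 2`
  have hn1 : d * (π - Q) / 2 ≤ |n - 1| := by
    have h1 : |n - 1 + (π - Q) * d| ≤ Cf * (π - Q) ^ 2 := by
      have e : n - 1 + (π - Q) * d = liebWuFillingAtCutoff U Q - 1 - (Q - π) * d := by rw [hfQ]; ring
      rw [e]; exact hrf
    have hCx : Cf * (π - Q) ≤ d / 2 := by
      calc Cf * (π - Q) ≤ Cf * (d / (2 * (Cf + 1))) := by gcongr; linarith
        _ ≤ d / 2 := by
            rw [mul_div_assoc', div_le_div_iff₀ (by positivity) two_pos]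
            nlinarith [hd0.le, hCf0]
    have h2 : Cf * (π - Q) ^ 2 ≤ d / 2 * (π - Q) := by
      calc Cf * (π - Q) ^ 2 = (Cf * (π - Q)) * (π - Q) := by ring
        _ ≤ d / 2 * (π - Q) := mul_le_mul_of_nonneg_right hCx hx0
    have h3 := (abs_le.1 h1).2
    calc d * (π - Q) / 2 ≤ 1 - n := by linarith
      _ ≤ |n - 1| := by rw [abs_sub_comm]; exact le_abs_self _
  -- `|δE - μ₋ δN| ≤ K (π - Q)² ≤ (ε d/2)(π - Q) ≤ ε |δN|`
  calc |(liebWuEnergyAtCutoff U Q - liebWuEnergyAtCutoff U π - (Q - π) * (d * μ)) -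
          (liebWuFillingAtCutoff U Q - 1 - (Q - π) * d) * μ|
      ≤ Ce * (π - Q) ^ 2 + Cf * (π - Q) ^ 2 * |μ| := by
        refine (abs_sub _ _).trans (add_le_add hre ?_)
        rw [abs_mul]
        exact mul_le_mul_of_nonneg_right hrf (abs_nonneg _)
    _ = (K * (π - Q)) * (π - Q) := by simp only [hK]; ring
    _ ≤ (ε * d / 2) * (π - Q) := by
        refine mul_le_mul_of_nonneg_right ?_ hx0
        calc K * (π - Q) ≤ K * (ε * d / (2 * (K + 1))) := by gcongr; linarith
          _ ≤ ε * d / 2 := by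
              rw [mul_div_assoc', div_le_div_iff₀ (by positivity) two_pos]
              nlinarith [mul_pos hε hd0, hK0]
    _ = ε * (d * (π - Q) / 2) := by ring
    _ ≤ ε * |n - 1| := mul_le_mul_of_nonneg_left hn1 hε.le

end Literature.MathematicalPhysics.QuantumLattice
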